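import Literature.AlgebraicGeometry.Hyperkaehler.K3HilbertMukaiLatticeEmbedding
import Literature.AlgebraicGeometry.Surfaces.K3PeriodSurjectivityProofs
import Literature.Topology.FourManifolds.LatticeFormsOrientationCharacter
import Literature.Topology.FourManifolds.LatticeFormsPrimitiveSublatticeDiscriminant
import Literature.Topology.FourManifolds.LatticeFormsOrthoSumSignature
import HarnessLib

/-!
# `O(Λ̃) × O⁺(Λ_n)` acts transitively on the primitive isometric embeddings `Λ_n ↪ Λ̃ = E₈(−1)^{⊕2} ⊕ U^{⊕4}`
# (Markman, *A survey of Torelli and monodromy results*, §9.1.2 Lemma 9.4; *Integral constraints …*, Lemma 4.3 (2))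

Layer `Literature/AlgebraicGeometry/Hyperkaehler`. Written for lane `lit-hodgefound` (Track 2 foundations; prover seat
`lit-hodgefound-p18`, gen 47, row g47-#9). Sequel of `K3HilbertMukaiLatticeEmbedding.lean` (row g47-#8: the embedding
`Λ_n ↪ Λ̃` with image `v^⊥`, `(v,v) = 2n − 2`, and the STABILISER half of Lemma 9.4: `{g | ∃ f ∈ O(Λ̃), f ∘ ι = ι ∘ g} =
{g | ḡ = ±id}` for every injective isometric `ι` onto some `v^⊥`). This file proves the TRANSITIVITY half, following
Markman's printed proof, and closes the loop: EVERY primitive isometric `ι : Λ_n → Λ̃` has image `v^⊥` for a `v` with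
`(v, v) = 2n − 2`. THEOREMS ONLY — no definition, no named fact, no instance, no notation.

## Source, verbatim (E. Markman, *Integral constraints on the monodromy group of the hyperkähler resolution of a
## symmetric product of a K3 surface*, Internat. J. Math. 21 (2010), §4.1; held text `paper:arxiv-math_0601304`
## pp. 19–20)

"Let `O(Λ, Λ̃)` be the set of primitive isometric embeddings of `Λ` into `Λ̃`. `O(Λ, Λ̃)` is endowed with a left
`O(Λ̃)`-action and a right `O(Λ)`-action. […] **Lemma 4.3.** […] (2) `O(Λ̃) × O(Λ)` acts transitively on `O(Λ, Λ̃)`. The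
stabilizer in `O(Λ)`, of every point in the orbit space `O(Λ̃)∖O(Λ, Λ̃)`, is generated by `𝒲(Λ)` and `−1`. The Lemma is
an easy consequence of Theorem 1.14.4 in [nikulin]. […] *Proof* […] (2) Let `ι : Λ ↪ Λ̃` be a primitive isometric
embedding. Then the orthogonal complement `ι(Λ)^⊥`, of its image, is generated by an element of square-length `2n − 2`.
There is a unique `O(Λ̃)`-orbit of such primitive elements ([nikulin] Theorem 1.14.4). The transitivity of the
`O(Λ) × O(Λ̃)` action follows." Survey, Lemma 9.4 (held text `paper:arxiv-1101.4606` p. 32): "`O⁺(Λ) × O(Λ̃)` acts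
transitively on `O(Λ, Λ̃)`."

## Proof as formalised (Markman's, with the two implicit steps spelled out)

* §1 For a symmetric unimodular `Λ` on `X` and a saturated `S ⊂ X` of corank one (`rk S + 1 = rk X`):
  `rk S^⊥ = 1` (`finrank_add_finrank_orthogonal_of_forall_smul_mem`), so `S^⊥ = ℤv`, and `S = (S^⊥)^⊥ = v^⊥`
  (`orthogonal_orthogonal_eq_of_forall_smul_mem`); `v` is primitive, `(v, v) ≠ 0` if `Λ|_S` is non-degenerate, and
  `|(v, v)| = |disc S|` (Ebeling Prop. 1.2, `natAbs_det_restrict_orthogonal_eq`) — "generated by an element of square-length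
  `2n − 2`" up to sign. The sign (implicit in the source): if `Λ` is even and `n₋(Λ) ≤ n₋(S)`, then `(v, v) > 0`, since
  `(x, c) ↦ x + c v` maps `S ⊕ ⟨(v, v)⟩` isometrically into `Λ` and `n₋` cannot grow (`sigNeg_le_sigNeg_of_comp`).
* §2 Given two saturated isometric images `S₁ = ι₁(L)`, `S₂ = ι₂(L)` with generators `v₁`, `v₂` of the complements:
  `(v₁, v₁) = (v₂, v₂)` (same absolute value `|disc L|`, both positive), both primitive, so Eichler's criterion in the even
  unimodular `Λ` with `n₊, n₋ ≥ 2` (`exists_isometryEquiv_apply_eq_of_primitive`, "[nikulin] Theorem 1.14.4") gives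
  `f ∈ O(Λ)` with `f v₁ = v₂`, hence `f(v₁^⊥) = v₂^⊥`, and `g := ι₂⁻¹ ∘ f ∘ ι₁ ∈ O(L)` satisfies `f ∘ ι₁ = ι₂ ∘ g`. If
  `n₊(L)` is odd, `−1 ∉ O⁺(L)` and `(f, g)` may be replaced by `(−f, −g)` to get `g ∈ O⁺(L)` (survey's form).
* §3 `Λ̃ = E₈(−1)^{⊕2} ⊕ U^{⊕4}` (even unimodular, signature `(4, 20)`), `L = Λ_n = toBilin' (k3HilbertGram n)`, `n ≥ 2`
  (rank `23`, signature `(3, 20)`, `|disc| = 2n − 2`).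

## References

* [Markman2010Constraints] E. Markman, Integral constraints on the monodromy group of the hyperkähler resolution of a
  symmetric product of a K3 surface, Internat. J. Math. 21 (2010) 169–223 (arXiv:math/0601304): §4.1 Lemma 4.3 (2).
* [Markman2011Survey] E. Markman, A survey of Torelli and monodromy results for holomorphic-symplectic varieties (2011)
  (arXiv:1101.4606): §9.1.2 Lemma 9.4.
* [Nikulin1980] V. V. Nikulin, Integral symmetric bilinear forms and some of their applications, Math. USSR Izv. 14
  (1980): Thm. 1.14.4.
* [Ebeling1994] W. Ebeling, Lattices and Codes (1994), §1.1 Prop. 1.2 (`disc Λ^⊥ = ± disc Λ` in a unimodular lattice).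
* [Huybrechts2016K3] D. Huybrechts, Lectures on K3 surfaces (2016), Ch. 14 §0.1, Cor. 1.3, Thm. 1.12 ∕ Rem. 1.13.
-/

noncomputable section

open Module Function
open LinearMap (BilinForm)
open Literature.Topology.FourManifolds Literature.AlgebraicGeometry.Surfaces

namespace LinearMap.BilinForm

/-! ### §1 Saturated corank-one sublattices of a unimodular lattice: `S^⊥ = ℤv`, `S = v^⊥`, `|(v,v)| = |disc S|`,
and the sign of `(v, v)` -/

section CorankOne

variable {X : Type*} [AddCommGroup X] [Module.Finite ℤ X] [Module.Free ℤ X] (Λ : BilinForm ℤ X)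
variable {M : Type*} [AddCommGroup M] [Module.Finite ℤ M] [Module.Free ℤ M] {L : BilinForm ℤ M}

/-- **The complement of a saturated corank-one sublattice of a unimodular lattice is `ℤv`, and `S = v^⊥`,
`|(v, v)| = |disc S|`** (`Λ` symmetric unimodular, `S` saturated, `rk S + 1 = rk Λ`, `disc S ≠ 0` in the basis `b_S`):
there is `v ≠ 0`, primitive, with `S^⊥ = ℤv`, `S = (ℤv)^⊥` and `|(v, v)| = |det (b_S i, b_S j)|` — "the orthogonal
complement `ι(Λ)^⊥`, of its image, is generated by an element of square-length `2n − 2`" (up to the sign, §1's last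
result). [cite: Markman2010Constraints, §4.1 proof of Lemma 4.3 (2)] [cite: Ebeling1994, §1.1 Prop. 1.2] -/
theorem exists_orthogonal_eq_span_singleton_of_finrank_add_one (hΛ : Λ.IsSymm) (hu : Λ.IsUnimodular)
    (S : Submodule ℤ X) (hsat : ∀ (k : ℤ) (x : X), k ≠ 0 → k • x ∈ S → x ∈ S)
    (hrank : finrank ℤ S + 1 = finrank ℤ X) {κ : Type*} [Fintype κ] [DecidableEq κ] (bS : Basis κ ℤ S)
    (hdet : (LinearMap.BilinForm.toMatrix bS (Λ.restrict S)).det ≠ 0) :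
    ∃ v : X, v ≠ 0 ∧ Λ.orthogonal S = ℤ ∙ v ∧ S = Λ.orthogonal (ℤ ∙ v) ∧
      (∀ (k : ℤ) (w : X), k ≠ 0 → k • w ∈ ℤ ∙ v → w ∈ ℤ ∙ v) ∧
      (Λ v v).natAbs = (LinearMap.BilinForm.toMatrix bS (Λ.restrict S)).det.natAbs := by
  haveI : Λ.IsPerfPair := hu
  have h1 : finrank ℤ (Λ.orthogonal S) = 1 := by
    have := Λ.finrank_add_finrank_orthogonal_of_forall_smul_mem S hΛ hsat
    omega
  let bN : Basis (Fin 1) ℤ (Λ.orthogonal S) := Module.finBasisOfFinrankEq ℤ _ h1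
  -- `S^⊥ = ℤ · b_N(0)`
  have hNv : Λ.orthogonal S = ℤ ∙ ((bN 0 : Λ.orthogonal S) : X) := by
    conv_lhs => rw [← Submodule.map_subtype_top (Λ.orthogonal S), ← bN.span_eq, Submodule.map_span]
    congr 1
    ext w
    simp only [Set.mem_image, Set.mem_range, Submodule.coe_subtype, Set.mem_singleton_iff]
    constructor
    · rintro ⟨_, ⟨i, rfl⟩, rfl⟩
      rw [Subsingleton.elim i 0]
    · rintro rfl
      exact ⟨bN 0, ⟨0, rfl⟩, rfl⟩
  refine ⟨(bN 0 : X), fun h ↦ bN.ne_zero 0 (Subtype.ext h), hNv, ?_, fun k w hk hw ↦ ?_, ?_⟩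
  · rw [← hNv, Λ.orthogonal_orthogonal_eq_of_forall_smul_mem S hΛ hsat]
  · rw [← hNv] at hw ⊢
    exact Λ.mem_orthogonal_of_smul_mem S hk hw
  · rw [← Λ.natAbs_det_restrict_orthogonal_eq S hΛ hu hsat bS bN hdet, Matrix.det_unique, LinearMap.BilinForm.toMatrix_apply]
    rfl

/-- **`(v, v) ≠ 0` for the generator of `S^⊥` when `Λ|_S` is non-degenerate** (`Λ` symmetric unimodular, `S`
saturated): `Λ|_{S^⊥}` is non-degenerate (Ebeling: "we can interchange the rôles of `Λ` and `Λ^⊥`") and `S^⊥ = ℤv`.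
[cite: Ebeling1994, §1.1 proof of Prop. 1.2] [cite: Markman2010Constraints, §4.1 proof of Lemma 4.3 (2)] -/
theorem apply_ne_zero_of_orthogonal_eq_span_singleton (hΛ : Λ.IsSymm) (hu : Λ.IsUnimodular) (S : Submodule ℤ X)
    (hsat : ∀ (k : ℤ) (x : X), k ≠ 0 → k • x ∈ S → x ∈ S) (hndS : (Λ.restrict S).Nondegenerate)
    {v : X} (hv0 : v ≠ 0) (hSv : Λ.orthogonal S = ℤ ∙ v) : Λ v v ≠ 0 := by
  haveI : Λ.IsPerfPair := hu
  intro hvv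
  have hN := Λ.nondegenerate_restrict_orthogonal S hΛ hsat hndS
  have hvN : v ∈ Λ.orthogonal S := by rw [hSv]; exact Submodule.mem_span_singleton_self v
  have key : (⟨v, hvN⟩ : Λ.orthogonal S) = 0 := hN.1 ⟨v, hvN⟩ fun n ↦ by
    obtain ⟨c, hc⟩ := Submodule.mem_span_singleton.1 (hSv ▸ n.2 : (n : X) ∈ ℤ ∙ v)
    change Λ v n = 0
    rw [← hc, map_smul, smul_eq_mul, hvv, mul_zero]
  exact hv0 (congrArg Subtype.val key)

omit [Module.Free ℤ X] [Module.Free ℤ M] in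
/-- **The sign: `(v, v) > 0`** when `Λ` is symmetric even, `ι : L → Λ` is isometric with `ι(L) ⊥ v`, `(v, v) ≠ 0`,
`L` symmetric and `n₋(Λ) ≤ n₋(L)`: otherwise `(x, c) ↦ ι x + c v` would be an isometric map `L ⊕ ⟨(v,v)⟩ → Λ` from a
form with `n₋ = n₋(L) + 1 > n₋(Λ)` (the index of inertia cannot decrease along isometric maps). For `Λ_n ↪ Λ̃`:
signatures `(3, 20)` and `(4, 20)`, so the complement is positive, "of square-length `2n − 2`".
[cite: Markman2010Constraints, §4.1 proof of Lemma 4.3 (2)] [cite: Serre1973, Ch. V §1.3.2] -/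
theorem apply_pos_of_sigNeg_le (hΛ : Λ.IsSymm) (he : Λ.IsEven) (hLs : L.IsSymm) {ι : M →ₗ[ℤ] X}
    (hιC : ∀ x y, Λ (ι x) (ι y) = L x y) {v : X} (hv : ∀ x, Λ (ι x) v = 0) (hv0 : Λ v v ≠ 0)
    (hneg : sigNeg Λ.toQuadraticMap ≤ sigNeg L.toQuadraticMap) : 0 < Λ v v := by
  by_contra hle
  obtain ⟨d, hd⟩ := he v
  have hd0 : d < 0 := by omega
  -- the isometric map `L ⊕ ⟨(v,v)⟩ → Λ`, `(x, c) ↦ ι x + c v`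
  have hφ : ∀ p q : M × ℤ, Λ ((ι.coprod (LinearMap.toSpanSingleton ℤ X v)) p)
      ((ι.coprod (LinearMap.toSpanSingleton ℤ X v)) q) = (L.prod ((-(2 * (-d))) • LinearMap.mul ℤ ℤ)) p q := by
    rintro ⟨x, c⟩ ⟨y, e⟩
    simp only [LinearMap.coprod_apply, LinearMap.toSpanSingleton_apply, map_add, map_smul, LinearMap.add_apply,
      LinearMap.smul_apply, smul_eq_mul, hιC, hv, LinearMap.BilinForm.prod_apply, LinearMap.mul_apply',
      hΛ.eq v (ι y)]
    rw [hd]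
    ring
  have h1 := sigNeg_le_sigNeg_of_comp _ _ _ hφ
  obtain ⟨-, hn1⟩ := sigPos_sigNeg_neg_two_mul_smul_mul (d := -d) (by omega)
  rw [sigNeg_prod _ _ hLs (isSymm_smul_mul _), hn1] at h1
  omega

omit [Module.Free ℤ M] in
/-- **The complement of a saturated corank-one isometric image `ι(L)`**, all in one (`Λ` symmetric even unimodular,
`L` symmetric non-degenerate, `rk L + 1 = rk Λ`, `n₋(Λ) ≤ n₋(L)`, `ι` injective isometric with saturated range): there is
a primitive `v` with `range ι = v^⊥`, `(range ι)^⊥ = ℤv`, `0 < (v, v)` and `|(v, v)| = |disc L|` (in any basis of `L`).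
[cite: Markman2010Constraints, §4.1 proof of Lemma 4.3 (2) ("generated by an element of square-length `2n−2`")] [cite: Ebeling1994, §1.1 Prop. 1.2] -/
theorem exists_range_eq_orthogonal_span_singleton (hΛ : Λ.IsSymm) (hu : Λ.IsUnimodular) (he : Λ.IsEven)
    (hLs : L.IsSymm) (hL : L.Nondegenerate) (hrank : finrank ℤ M + 1 = finrank ℤ X)
    (hneg : sigNeg Λ.toQuadraticMap ≤ sigNeg L.toQuadraticMap) {ι : M →ₗ[ℤ] X} (hinj : Injective ι)
    (hιC : ∀ x y, Λ (ι x) (ι y) = L x y)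
    (hsat : ∀ (k : ℤ) (z : X), k ≠ 0 → k • z ∈ LinearMap.range ι → z ∈ LinearMap.range ι)
    {κ : Type*} [Fintype κ] [DecidableEq κ] (bL : Basis κ ℤ M) :
    ∃ v : X, (∀ (k : ℤ) (w : X), k ≠ 0 → k • w ∈ ℤ ∙ v → w ∈ ℤ ∙ v) ∧
      LinearMap.range ι = Λ.orthogonal (ℤ ∙ v) ∧ Λ.orthogonal (LinearMap.range ι) = ℤ ∙ v ∧ 0 < Λ v v ∧
      (Λ v v).natAbs = (LinearMap.BilinForm.toMatrix bL L).det.natAbs := by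
  obtain ⟨e, he'⟩ := Λ.exists_isometryEquiv_restrict_of_range_eq hinj hιC (N := LinearMap.range ι) rfl
  -- the basis `e(b_L)` of `range ι` has the Gram matrix of `b_L`
  have hGram : LinearMap.BilinForm.toMatrix (bL.map e.toLinearEquiv) (Λ.restrict (LinearMap.range ι)) =
      LinearMap.BilinForm.toMatrix bL L := by
    ext i j
    rw [LinearMap.BilinForm.toMatrix_apply, LinearMap.BilinForm.toMatrix_apply, Basis.map_apply, Basis.map_apply]
    exact e.map_app (bL j) (bL i)
  have hdetL : (LinearMap.BilinForm.toMatrix bL L).det ≠ 0 := (nondegenerate_iff_det_ne_zero bL).1 hL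
  have hrank' : finrank ℤ (LinearMap.range ι) + 1 = finrank ℤ X := by
    rw [LinearMap.finrank_range_of_inj hinj, hrank]
  obtain ⟨v, hv0, hSv, hS, hprim, habs⟩ := Λ.exists_orthogonal_eq_span_singleton_of_finrank_add_one hΛ hu
    (LinearMap.range ι) hsat hrank' (bL.map e.toLinearEquiv) (by rw [hGram]; exact hdetL)
  rw [hGram] at habs
  have hndS : (Λ.restrict (LinearMap.range ι)).Nondegenerate := e.nondegenerate hL
  have hvv := Λ.apply_ne_zero_of_orthogonal_eq_span_singleton hΛ hu _ hsat hndS hv0 hSv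
  have hv : ∀ x, Λ (ι x) v = 0 := fun x ↦ by
    have hx : ι x ∈ Λ.orthogonal (ℤ ∙ v) := hS ▸ LinearMap.mem_range_self ι x
    rw [mem_orthogonal_span_singleton_iff] at hx
    rw [hΛ.eq, hx]
  exact ⟨v, hprim, hS, hSv, Λ.apply_pos_of_sigNeg_le hΛ he hLs hιC hv hvv hneg, habs⟩

end CorankOne

/-! ### §2 Transitivity: two saturated isometric images of `L` of corank one are conjugate under `O(Λ) × O(L)`
(resp. `O(Λ) × O⁺(L)`) -/

section Transitive

variable {X : Type*} [AddCommGroup X] [Module.Finite ℤ X] [Module.Free ℤ X] (Λ : BilinForm ℤ X)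
variable {M : Type*} [AddCommGroup M] [Module.Finite ℤ M] [Module.Free ℤ M] (L : BilinForm ℤ M)

/-- **Lemma 4.3 (2), transitivity: `O(Λ) × O(L)` acts transitively on the primitive isometric embeddings `L ↪ Λ`
of corank one** — for `Λ` symmetric even unimodular with `n₊(Λ), n₋(Λ) ≥ 2`, `L` symmetric non-degenerate,
`rk L + 1 = rk Λ` and `n₋(L) = n₋(Λ)`: any two injective isometric `ι₁, ι₂ : L → Λ` with saturated ranges satisfy
`f ∘ ι₁ = ι₂ ∘ g` for some `f ∈ O(Λ)`, `g ∈ O(L)`. Markman's proof: the complements are `ℤv₁`, `ℤv₂` with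
`(v₁, v₁) = (v₂, v₂)` (§1), "There is a unique `O(Λ̃)`-orbit of such primitive elements ([nikulin] Theorem 1.14.4)" —
Eichler's criterion moves `v₁` to `v₂`, hence `v₁^⊥ = ι₁(L)` onto `v₂^⊥ = ι₂(L)`, and `g = ι₂⁻¹ ∘ f ∘ ι₁`.
[cite: Markman2010Constraints, §4.1 Lemma 4.3 (2)] [cite: Nikulin1980, Thm. 1.14.4] -/
theorem exists_isometryEquiv_comp_eq_comp_of_saturated (hΛ : Λ.IsSymm) (hu : Λ.IsUnimodular) (he : Λ.IsEven)
    (h2 : 2 ≤ sigPos Λ.toQuadraticMap) (h2' : 2 ≤ sigNeg Λ.toQuadraticMap) (hLs : L.IsSymm) (hL : L.Nondegenerate)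
    (hrank : finrank ℤ M + 1 = finrank ℤ X) (hneg : sigNeg L.toQuadraticMap = sigNeg Λ.toQuadraticMap)
    {ι₁ ι₂ : M →ₗ[ℤ] X} (h₁ : Injective ι₁) (h₁C : ∀ x y, Λ (ι₁ x) (ι₁ y) = L x y)
    (h₁sat : ∀ (k : ℤ) (z : X), k ≠ 0 → k • z ∈ LinearMap.range ι₁ → z ∈ LinearMap.range ι₁)
    (h₂ : Injective ι₂) (h₂C : ∀ x y, Λ (ι₂ x) (ι₂ y) = L x y)
    (h₂sat : ∀ (k : ℤ) (z : X), k ≠ 0 → k • z ∈ LinearMap.range ι₂ → z ∈ LinearMap.range ι₂) :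
    ∃ (f : Λ.IsometryEquiv Λ) (g : L.IsometryEquiv L), ∀ x, f (ι₁ x) = ι₂ (g x) := by
  classical
  let bL := Module.Free.chooseBasis ℤ M
  obtain ⟨v₁, hp₁, hS₁, -, hpos₁, habs₁⟩ :=
    Λ.exists_range_eq_orthogonal_span_singleton hΛ hu he hLs hL hrank hneg.ge h₁ h₁C h₁sat bL
  obtain ⟨v₂, hp₂, hS₂, -, hpos₂, habs₂⟩ :=
    Λ.exists_range_eq_orthogonal_span_singleton hΛ hu he hLs hL hrank hneg.ge h₂ h₂C h₂sat bL
  -- `(v₁, v₁) = (v₂, v₂)`: same absolute value `|disc L|`, both positive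
  have hvv : Λ v₁ v₁ = Λ v₂ v₂ := by
    rcases Int.natAbs_eq_natAbs_iff.1 (habs₁.trans habs₂.symm) with h | h
    · exact h
    · omega
  have hv₁0 : v₁ ≠ 0 := by rintro rfl; simp at hpos₁
  have hv₂0 : v₂ ≠ 0 := by rintro rfl; simp at hpos₂
  -- Eichler: `f v₁ = v₂`
  obtain ⟨f, hf⟩ := exists_isometryEquiv_apply_eq_of_primitive Λ hΛ hu he h2 h2' hvv hv₁0 hp₁ hv₂0 hp₂
  -- `f(ι₁(L)) = ι₂(L)`
  have hmap : (Λ.orthogonal (ℤ ∙ v₁)).map (f.toLinearEquiv : X →ₗ[ℤ] X) = Λ.orthogonal (ℤ ∙ v₂) := by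
    rw [map_orthogonal_span_singleton, hf]
  obtain ⟨e₁, he₁⟩ := Λ.exists_isometryEquiv_restrict_of_range_eq h₁ h₁C hS₁
  obtain ⟨e₂, he₂⟩ := Λ.exists_isometryEquiv_restrict_of_range_eq h₂ h₂C hS₂
  let F : (Λ.restrict (Λ.orthogonal (ℤ ∙ v₁))).IsometryEquiv (Λ.restrict (Λ.orthogonal (ℤ ∙ v₂))) :=
    { f.toLinearEquiv.ofSubmodules _ _ hmap with
      map_app' := fun p q ↦ f.map_app (q : X) (p : X) }
  have hF : ∀ p : Λ.orthogonal (ℤ ∙ v₁), (F p : X) = f p := fun p ↦ rfl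
  refine ⟨f, e₁.trans (F.trans e₂.symm), fun x ↦ ?_⟩
  rw [← he₂, IsometryEquiv.trans_apply, IsometryEquiv.trans_apply, IsometryEquiv.apply_symm_apply, hF, he₁]

/-- **Lemma 9.4: `O⁺(L) × O(Λ)` acts transitively** — the same with `g ∈ O⁺(L)` when `n₊(L)` is odd (then
`−1 ∉ O⁺(L)`, and `(f, g)` may be replaced by `(−f, −g)`); for `L = Λ_n`, `n₊ = 3`.
[cite: Markman2011Survey, §9.1.2 Lemma 9.4 ("`O⁺(Λ) × O(Λ̃)` acts transitively on `O(Λ, Λ̃)`")] [cite: Markman2010Constraints, §4.1 Lemma 4.3 (2)] [cite: Huybrechts2016K3, Ch. 7 §5.4] -/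
theorem exists_isometryEquiv_isOrientationPreserving_comp_eq_comp_of_saturated (hΛ : Λ.IsSymm)
    (hu : Λ.IsUnimodular) (he : Λ.IsEven) (h2 : 2 ≤ sigPos Λ.toQuadraticMap) (h2' : 2 ≤ sigNeg Λ.toQuadraticMap)
    (hLs : L.IsSymm) (hL : L.Nondegenerate) (hodd : Odd (sigPos L.toQuadraticMap))
    (hrank : finrank ℤ M + 1 = finrank ℤ X) (hneg : sigNeg L.toQuadraticMap = sigNeg Λ.toQuadraticMap)
    {ι₁ ι₂ : M →ₗ[ℤ] X} (h₁ : Injective ι₁) (h₁C : ∀ x y, Λ (ι₁ x) (ι₁ y) = L x y)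
    (h₁sat : ∀ (k : ℤ) (z : X), k ≠ 0 → k • z ∈ LinearMap.range ι₁ → z ∈ LinearMap.range ι₁)
    (h₂ : Injective ι₂) (h₂C : ∀ x y, Λ (ι₂ x) (ι₂ y) = L x y)
    (h₂sat : ∀ (k : ℤ) (z : X), k ≠ 0 → k • z ∈ LinearMap.range ι₂ → z ∈ LinearMap.range ι₂) :
    ∃ (f : Λ.IsometryEquiv Λ) (g : L.IsometryEquiv L), g.IsOrientationPreserving ∧ ∀ x, f (ι₁ x) = ι₂ (g x) := by
  obtain ⟨f, g, hfg⟩ := Λ.exists_isometryEquiv_comp_eq_comp_of_saturated L hΛ hu he h2 h2' hLs hL hrank hneg h₁ h₁C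
    h₁sat h₂ h₂C h₂sat
  by_cases hg : g.IsOrientationPreserving
  · exact ⟨f, g, hg, hfg⟩
  · refine ⟨(IsometryEquiv.neg Λ).trans f, (IsometryEquiv.neg L).trans g, ?_, fun x ↦ ?_⟩
    · rw [IsometryEquiv.isOrientationPreserving_neg_trans_iff L hLs hL]
      exact iff_of_false hg (Nat.not_even_iff_odd.2 hodd)
    · rw [IsometryEquiv.trans_apply, IsometryEquiv.neg_apply, map_neg, hfg, IsometryEquiv.trans_apply,
        IsometryEquiv.neg_apply, map_neg, map_neg]

end Transitive

end LinearMap.BilinForm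

/-! ### §3 `Λ_n ↪ Λ̃ = E₈(−1)^{⊕2} ⊕ U^{⊕4}`: every primitive embedding has complement `ℤv`, `(v, v) = 2n − 2`;
transitivity of `O(Λ̃) × O⁺(Λ_n)`; the stabiliser of every orbit -/

namespace Literature.AlgebraicGeometry.Hyperkaehler

open Literature.Topology.FourManifolds Literature.AlgebraicGeometry.Surfaces LinearMap.BilinForm

/-- `rk Λ̃ = 24` for the coordinate Mukai lattice. [cite: Huybrechts2016K3, Ch. 14 §0.3 (vi)] -/
private theorem finrank_mukai_carrier : finrank ℤ ((Fin 2 → Fin 8 → ℤ) × ((Fin 4 → ℤ) × (Fin 4 → ℤ))) = 24 := by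
  rw [finrank_pi_e8Form_prod_hyperbolicSum_carrier]

/-- `det Λ_n = 2n − 2` (block matrix `Λ_{K3} ⊕ (2 − 2n)`, `det Λ_{K3} = −1`). [cite: GritsenkoHulekSankaran2010Symplectic, §4 ("`2t = −det(L_{2t})`")] -/
private theorem det_k3HilbertGram (n : ℕ) : (k3HilbertGram n).det = 2 * n - 2 := by
  rw [k3HilbertGram, Matrix.det_fromBlocks_zero₂₁, k3Gram_det, Matrix.det_unique, Matrix.of_apply]
  ring

/-- `|disc Λ_n| = 2(n − 1)` in the basis of record. [cite: GritsenkoHulekSankaran2010Symplectic, §4 ("the discriminant group of `L_{2t}` is cyclic" of order `2t`)] -/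
private theorem natAbs_det_toMatrix_k3HilbertGram (n : ℕ) (hn : 1 ≤ n) :
    (LinearMap.BilinForm.toMatrix (Pi.basisFun ℤ K3HilbertIndex) (Matrix.toBilin' (k3HilbertGram n))).det.natAbs =
      2 * (n - 1) := by
  rw [LinearMap.BilinForm.toMatrix_basisFun, LinearMap.BilinForm.toMatrix'_toBilin', det_k3HilbertGram]
  omega

/-- **Every primitive isometric embedding `ι : Λ_n ↪ Λ̃` has `ι(Λ_n)^⊥ = ℤv` with `(v, v) = 2n − 2`, `v` primitive, and
`ι(Λ_n) = v^⊥`** (`n ≥ 2`) — "the orthogonal complement `ι(Λ)^⊥`, of its image, is generated by an element of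
square-length `2n − 2`" (`|(v, v)| = |disc Λ_n| = 2n − 2` by Ebeling Prop. 1.2; the sign by the signatures
`(3, 20) ⊂ (4, 20)`). [cite: Markman2010Constraints, §4.1 proof of Lemma 4.3 (2)] [cite: Markman2011Survey, §9.1.2 (Thm. 9.3 (3): "`(c̄₂(X)/2, c̄₂(X)/2) = 2n−2`")] [cite: Ebeling1994, §1.1 Prop. 1.2] -/
theorem k3HilbertLattice_exists_range_eq_orthogonal_of_saturated {n : ℕ} (hn : 2 ≤ n)
    {ι : (K3HilbertIndex → ℤ) →ₗ[ℤ] (Fin 2 → Fin 8 → ℤ) × ((Fin 4 → ℤ) × (Fin 4 → ℤ))} (hinj : Function.Injective ι)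
    (hιC : ∀ x y, ((LinearMap.BilinForm.pi fun _ : Fin 2 ↦ -e8Form).prod (hyperbolicSum 4)) (ι x) (ι y) =
      Matrix.toBilin' (k3HilbertGram n) x y)
    (hsat : ∀ (k : ℤ) z, k ≠ 0 → k • z ∈ LinearMap.range ι → z ∈ LinearMap.range ι) :
    ∃ v : (Fin 2 → Fin 8 → ℤ) × ((Fin 4 → ℤ) × (Fin 4 → ℤ)),
      (∀ (k : ℤ) w, k ≠ 0 → k • w ∈ ℤ ∙ v → w ∈ ℤ ∙ v) ∧
      LinearMap.range ι = ((LinearMap.BilinForm.pi fun _ : Fin 2 ↦ -e8Form).prod (hyperbolicSum 4)).orthogonal (ℤ ∙ v) ∧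
      ((LinearMap.BilinForm.pi fun _ : Fin 2 ↦ -e8Form).prod (hyperbolicSum 4)).orthogonal (LinearMap.range ι) =
        ℤ ∙ v ∧
      ((LinearMap.BilinForm.pi fun _ : Fin 2 ↦ -e8Form).prod (hyperbolicSum 4)) v v = 2 * (n - 1 : ℕ) := by
  classical
  obtain ⟨hs, hev, hu⟩ := isSymm_isEven_isUnimodular_pi_neg_e8Form_prod_hyperbolicSum' 2 4
  obtain ⟨-, hng⟩ := sigPos_sigNeg_pi_neg_e8Form_prod_hyperbolicSum 2 4
  obtain ⟨-, hnL⟩ := sigPos_sigNeg_toBilin'_k3HilbertGram hn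
  have hrank : finrank ℤ (K3HilbertIndex → ℤ) + 1 = finrank ℤ ((Fin 2 → Fin 8 → ℤ) × ((Fin 4 → ℤ) × (Fin 4 → ℤ))) := by
    rw [finrank_k3HilbertIndex_fun, finrank_mukai_carrier]
  obtain ⟨v, hprim, hS, hSv, hpos, habs⟩ := exists_range_eq_orthogonal_span_singleton _ hs hu hev
    (isSymm_toBilin'_k3HilbertGram n) (nondegenerate_toBilin'_k3HilbertGram hn) hrank (by rw [hng, hnL]) hinj hιC
    hsat (Pi.basisFun ℤ K3HilbertIndex)
  refine ⟨v, hprim, hS, hSv, ?_⟩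
  rw [natAbs_det_toMatrix_k3HilbertGram n (by omega)] at habs
  rw [← Int.natAbs_of_nonneg hpos.le, habs]
  push_cast
  ring

/-- **Lemma 4.3 (2) ∕ Lemma 9.4, transitivity, for `Λ_n ↪ Λ̃`: `O(Λ̃) × O⁺(Λ_n)` acts transitively on the primitive
isometric embeddings of `Λ_n = toBilin' (k3HilbertGram n)` (`n ≥ 2`) into the Mukai lattice `E₈(−1)^{⊕2} ⊕ U^{⊕4}`** —
any two differ by `f ∈ O(Λ̃)` on the target and an ORIENTATION-PRESERVING `g ∈ O(Λ_n)` on the source: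
`f ∘ ι₁ = ι₂ ∘ g`. [cite: Markman2011Survey, §9.1.2 Lemma 9.4] [cite: Markman2010Constraints, §4.1 Lemma 4.3 (2)] [cite: Nikulin1980, Thm. 1.14.4] -/
theorem k3HilbertLattice_exists_isometryEquiv_comp_eq_comp {n : ℕ} (hn : 2 ≤ n)
    {ι₁ ι₂ : (K3HilbertIndex → ℤ) →ₗ[ℤ] (Fin 2 → Fin 8 → ℤ) × ((Fin 4 → ℤ) × (Fin 4 → ℤ))}
    (h₁ : Function.Injective ι₁)
    (h₁C : ∀ x y, ((LinearMap.BilinForm.pi fun _ : Fin 2 ↦ -e8Form).prod (hyperbolicSum 4)) (ι₁ x) (ι₁ y) =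
      Matrix.toBilin' (k3HilbertGram n) x y)
    (h₁sat : ∀ (k : ℤ) z, k ≠ 0 → k • z ∈ LinearMap.range ι₁ → z ∈ LinearMap.range ι₁)
    (h₂ : Function.Injective ι₂)
    (h₂C : ∀ x y, ((LinearMap.BilinForm.pi fun _ : Fin 2 ↦ -e8Form).prod (hyperbolicSum 4)) (ι₂ x) (ι₂ y) =
      Matrix.toBilin' (k3HilbertGram n) x y)
    (h₂sat : ∀ (k : ℤ) z, k ≠ 0 → k • z ∈ LinearMap.range ι₂ → z ∈ LinearMap.range ι₂) :
    ∃ (f : ((LinearMap.BilinForm.pi fun _ : Fin 2 ↦ -e8Form).prod (hyperbolicSum 4)).IsometryEquiv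
        ((LinearMap.BilinForm.pi fun _ : Fin 2 ↦ -e8Form).prod (hyperbolicSum 4)))
      (g : (Matrix.toBilin' (k3HilbertGram n)).IsometryEquiv (Matrix.toBilin' (k3HilbertGram n))),
      g.IsOrientationPreserving ∧ ∀ x, f (ι₁ x) = ι₂ (g x) := by
  obtain ⟨hs, hev, hu⟩ := isSymm_isEven_isUnimodular_pi_neg_e8Form_prod_hyperbolicSum' 2 4
  obtain ⟨hp, hng⟩ := sigPos_sigNeg_pi_neg_e8Form_prod_hyperbolicSum 2 4
  obtain ⟨hpL, hnL⟩ := sigPos_sigNeg_toBilin'_k3HilbertGram hn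
  have hrank : finrank ℤ (K3HilbertIndex → ℤ) + 1 = finrank ℤ ((Fin 2 → Fin 8 → ℤ) × ((Fin 4 → ℤ) × (Fin 4 → ℤ))) := by
    rw [finrank_k3HilbertIndex_fun, finrank_mukai_carrier]
  exact exists_isometryEquiv_isOrientationPreserving_comp_eq_comp_of_saturated _ _ hs hu hev (by rw [hp]; norm_num)
    (by rw [hng]; norm_num) (isSymm_toBilin'_k3HilbertGram n) (nondegenerate_toBilin'_k3HilbertGram hn)
    (by rw [hpL]; exact ⟨1, rfl⟩) hrank (by rw [hnL, hng]) h₁ h₁C h₁sat h₂ h₂C h₂sat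

/-- **Lemma 9.4, both halves combined: the stabiliser of EVERY `O(Λ̃)`-orbit in `O(Λ_n, Λ̃)` is `{g | ḡ = ±id}`**
(`n ≥ 2`; `∩ O⁺(Λ_n)` = Markman's `N`): for any primitive isometric `ι : Λ_n ↪ Λ̃` (no hypothesis on its image),
`{g ∈ O(Λ_n) | ∃ f ∈ O(Λ̃), f ∘ ι = ι ∘ g} = {g | ḡ = id ∨ ḡ = −id}` — its image is `v^⊥`, `(v, v) = 2n − 2 ≠ 0`, by
the first theorem of this section, and row g47-#8 applies. "The subgroup `N ⊂ O⁺(Λ)` … is equal to the stabilizer in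
`O⁺(Λ)` of every point in the orbit space `O(Λ, Λ̃)/O(Λ̃)`."
[cite: Markman2011Survey, §9.1.2 Lemma 9.4] [cite: Markman2010Constraints, §4.1 Lemma 4.3 (2)] -/
theorem k3HilbertLattice_setOf_exists_isometryEquiv_comp_eq_of_saturated {n : ℕ} (hn : 2 ≤ n)
    {ι : (K3HilbertIndex → ℤ) →ₗ[ℤ] (Fin 2 → Fin 8 → ℤ) × ((Fin 4 → ℤ) × (Fin 4 → ℤ))} (hinj : Function.Injective ι)
    (hιC : ∀ x y, ((LinearMap.BilinForm.pi fun _ : Fin 2 ↦ -e8Form).prod (hyperbolicSum 4)) (ι x) (ι y) =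
      Matrix.toBilin' (k3HilbertGram n) x y)
    (hsat : ∀ (k : ℤ) z, k ≠ 0 → k • z ∈ LinearMap.range ι → z ∈ LinearMap.range ι) :
    {g : (Matrix.toBilin' (k3HilbertGram n)).IsometryEquiv (Matrix.toBilin' (k3HilbertGram n)) |
        ∃ f : ((LinearMap.BilinForm.pi fun _ : Fin 2 ↦ -e8Form).prod (hyperbolicSum 4)).IsometryEquiv
          ((LinearMap.BilinForm.pi fun _ : Fin 2 ↦ -e8Form).prod (hyperbolicSum 4)), ∀ x, f (ι x) = ι (g x)} =
      {g | (∀ a, g.discriminantGroupCongr a = a) ∨ (∀ a, g.discriminantGroupCongr a = -a)} := by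
  obtain ⟨v, -, hS, -, hvv⟩ := k3HilbertLattice_exists_range_eq_orthogonal_of_saturated hn hinj hιC hsat
  exact k3HilbertLattice_setOf_exists_isometryEquiv_comp_eq hinj hιC (by rw [hvv]; omega) hS

end Literature.AlgebraicGeometry.Hyperkaehler

end
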